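import Mathlib
import Summits.CriticalPhenomena.PercolationContinuityZ3.Theorems.PercNearOneGluingNoHeavyLowerTailMomentRatioTN
import HarnessLib

/-!
# THEOREM W: `(l + c_n)/(n-l)!` is totally nonnegative for Beta-product (Stieltjes-type) `c`

Support file for the Sahi / Conjecture-P programme of route `PercNearOneGluingNoHeavy`
(`--supports stmt-CriticalPhenomena-4575`, prover prim-l12-p5 gen 35; proof note
`prim-l12-p5/PROOF-CONJECTURE-W-g35.md` §5).  No definitions, no named facts, no sorries.

`…LowerTailMomentRatioTN.lPlusC_div_factorial_tn` reduces total nonnegativity of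
`[(l + c_n)/(n-l)!]_{l ≤ n}` to STRICT COMPLETE MONOTONICITY of `μ_r = r!/∏_{m ≤ r}(m + c_m)`.  Here we
supply the instances:

* `altSum_pochRatio` — for `0 < a`, `0 < b`: the Hausdorff differences of the Pochhammer ratio
  `μ_r = ∏_{m<r} (a+m)/(b+m)` (the moments of `Beta(a, b-a)` when `a < b`) are
  `μ_j · ∏_{i<k}(b-a+i) / ∏_{i<k}(b+j+i)` — positive when `a < b`;
* `altSum_mul` (Leibniz rule) and `altSum_mul_pos` — products of strictly completely monotone
  sequences are strictly completely monotone; `altSum_prod_pochRatio_pos` — finite products of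
  Pochhammer ratios;
* **THEOREM W** (`lPlusC_div_factorial_tn_of_pochRatio`): if `m/(m + c_m) = ∏_i (a_i+m-1)/(b_i+m-1)`
  (`m ≥ 1`) with `0 < a_i < b_i`, then `[(l + c_n)/(n-l)!]` is totally nonnegative.  Every Stieltjes-type
  `c(x) = A - Σ_{i≤p} w_i/(x+t_i)` with `w_i, t_i > 0`, `c(0) > 0` is of this form with `a_i = t_i + 1`,
  `b_i = s_{p-i} + 1` (`t_0 = 0`; `-s_j` the zeros of `x + c(x)`, which interlace the poles; memo §5),
  as is g34's two-ray `c` (memo §6, Meixner zeros); `c ≡ A` is the case `p = 0`, `a = 1`, `b = A + 1`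
  (`lPlusC_div_factorial_tn_const`).
-/

namespace Summit.CriticalPhenomena.PercolationContinuityZ3.Theorems

namespace MomentRatioTN

open Finset Matrix
open scoped Nat

/-! ### Hausdorff differences of Pochhammer ratios -/

/-- Telescoping: `∏_{m<r} (b+m)/(b+1+m) = b/(b+r)`. -/
theorem prod_ratio_telescope (b : ℝ) (hb : 0 < b) (r : ℕ) :
    ∏ m ∈ range r, (b + m) / (b + 1 + m) = b / (b + r) := by
  induction r with
  | zero => simp [div_self hb.ne']
  | succ r ih =>
    rw [prod_range_succ, ih]
    have h1 : b + r ≠ 0 := by positivity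
    have h2 : b + 1 + r ≠ 0 := by positivity
    have h3 : b + (r + 1 : ℕ) ≠ 0 := by positivity
    push_cast
    field_simp
    ring

/-- One difference of a Pochhammer ratio: `μ_r - μ_{r+1} = ((b-a)/b) · ∏_{m<r}(a+m)/(b+1+m)`. -/
theorem pochRatio_diff (a b : ℝ) (hb : 0 < b) (r : ℕ) :
    ∏ m ∈ range r, (a + m) / (b + m) - ∏ m ∈ range (r + 1), (a + m) / (b + m) =
      (b - a) / b * ∏ m ∈ range r, (a + m) / (b + 1 + m) := by
  have hsplit : ∏ m ∈ range r, (a + m) / (b + 1 + m) =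
      (∏ m ∈ range r, (a + m) / (b + m)) * ∏ m ∈ range r, (b + m) / (b + 1 + m) := by
    rw [← prod_mul_distrib]
    refine prod_congr rfl fun m _ => ?_
    have h1 : b + m ≠ 0 := by positivity
    field_simp
  rw [hsplit, prod_ratio_telescope b hb, prod_range_succ]
  have h1 : b + r ≠ 0 := by positivity
  field_simp
  ring

/-- **Hausdorff differences of a Pochhammer ratio.**  For `0 < b`:
`Σ_{i ≤ k} (-1)^i C(k,i) μ_{j+i} = μ_j · ∏_{i<k}(b-a+i) / ∏_{i<k}(b+j+i)`, `μ_r = ∏_{m<r}(a+m)/(b+m)`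
(the `Beta(a,b-a)` moments when `0 < a < b`: `E[Y^j (1-Y)^k]`). -/
theorem altSum_pochRatio (a : ℝ) (k : ℕ) : ∀ (b : ℝ), 0 < b → ∀ j : ℕ,
    ∑ i ∈ range (k + 1), (-1 : ℝ) ^ i * (k.choose i : ℝ) *
        ∏ m ∈ range (j + i), (a + m) / (b + m) =
      (∏ m ∈ range j, (a + m) / (b + m)) * (∏ i ∈ range k, (b - a + i)) /
        ∏ i ∈ range k, (b + j + i) := by
  induction k with
  | zero => intro b hb j; simp
  | succ k ih =>
    intro b hb j
    rw [altSum_succ (fun r => ∏ m ∈ range r, (a + m) / (b + m)) k j]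
    have hterm : ∀ i ∈ range (k + 1), (-1 : ℝ) ^ i * (k.choose i : ℝ) *
        (∏ m ∈ range (j + i), (a + m) / (b + m) - ∏ m ∈ range (j + i + 1), (a + m) / (b + m)) =
        (b - a) / b * ((-1 : ℝ) ^ i * (k.choose i : ℝ) *
          ∏ m ∈ range (j + i), (a + m) / (b + 1 + m)) := by
      intro i _
      rw [pochRatio_diff a b hb]
      ring
    rw [sum_congr rfl hterm, ← mul_sum, ih (b + 1) (by positivity) j]
    -- μ^{(b+1)}_j = μ_j · b/(b+j)
    have hsplit : ∏ m ∈ range j, (a + m) / (b + 1 + m) =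
        (∏ m ∈ range j, (a + m) / (b + m)) * (b / (b + j)) := by
      rw [← prod_ratio_telescope b hb j, ← prod_mul_distrib]
      refine prod_congr rfl fun m _ => ?_
      have h1 : b + m ≠ 0 := by positivity
      field_simp
    rw [hsplit, prod_range_succ' (fun i => b - a + (i : ℕ)), prod_range_succ' (fun i => b + j + (i : ℕ))]
    have h1 : b + j ≠ 0 := by positivity
    have h2 : ∏ i ∈ range k, (b + 1 + j + i) ≠ 0 := (prod_pos fun i _ => by positivity).ne'
    have e1 : ∏ i ∈ range k, (b + 1 - a + (i : ℕ)) = ∏ i ∈ range k, (b - a + ((i + 1 : ℕ) : ℝ)) :=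
      prod_congr rfl fun i _ => by push_cast; ring
    have e2 : ∏ i ∈ range k, (b + 1 + j + (i : ℕ)) = ∏ i ∈ range k, (b + j + ((i + 1 : ℕ) : ℝ)) :=
      prod_congr rfl fun i _ => by push_cast; ring
    rw [← e1, ← e2]
    push_cast
    field_simp
    ring

/-- Positivity: for `0 < a < b` the Pochhammer ratio is strictly completely monotone. -/
theorem altSum_pochRatio_pos (a b : ℝ) (ha : 0 < a) (hab : a < b) (k j : ℕ) :
    0 < ∑ i ∈ range (k + 1), (-1 : ℝ) ^ i * (k.choose i : ℝ) *
        ∏ m ∈ range (j + i), (a + m) / (b + m) := by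
  have hb : 0 < b := ha.trans hab
  rw [altSum_pochRatio a k b hb j]
  have hba : 0 < b - a := sub_pos.2 hab
  exact div_pos (mul_pos (prod_pos fun m _ => by positivity) (prod_pos fun i _ => by positivity))
    (prod_pos fun i _ => by positivity)

/-! ### Products (Leibniz rule for Hausdorff differences) -/

/-- The other Pascal form: `D_{k+1} h (j) = D_k h (j) - D_k h (j+1)`. -/
theorem altSum_succ' (h : ℕ → ℝ) (k j : ℕ) :
    ∑ i ∈ range (k + 2), (-1 : ℝ) ^ i * ((k + 1).choose i : ℝ) * h (j + i) =
      ∑ i ∈ range (k + 1), (-1 : ℝ) ^ i * (k.choose i : ℝ) * h (j + i) -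
        ∑ i ∈ range (k + 1), (-1 : ℝ) ^ i * (k.choose i : ℝ) * h (j + 1 + i) := by
  rw [altSum_succ, ← sum_sub_distrib]
  refine sum_congr rfl fun i _ => ?_
  rw [show j + 1 + i = j + i + 1 by ring]
  ring

/-- Pascal reindexing: `Σ_{i ≤ k+1} C(k+1,i) T_i = Σ_{i ≤ k} C(k,i) T_i + Σ_{i ≤ k} C(k,i) T_{i+1}`. -/
theorem pascal_sum (T : ℕ → ℝ) (k : ℕ) :
    ∑ i ∈ range (k + 2), ((k + 1).choose i : ℝ) * T i =
      ∑ i ∈ range (k + 1), (k.choose i : ℝ) * T i + ∑ i ∈ range (k + 1), (k.choose i : ℝ) * T (i + 1) := by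
  rw [sum_range_succ' (fun i => ((k + 1).choose i : ℝ) * T i)]
  simp only [Nat.choose_succ_succ, Nat.cast_add, add_mul, sum_add_distrib, Nat.choose_zero_right,
    Nat.cast_one, one_mul]
  have h1 : ∑ i ∈ range (k + 1), (k.choose (i + 1) : ℝ) * T (i + 1) + T 0 =
      ∑ i ∈ range (k + 1), (k.choose i : ℝ) * T i := by
    rw [sum_range_succ (fun i => (k.choose (i + 1) : ℝ) * T (i + 1)),
      Nat.choose_eq_zero_of_lt (Nat.lt_succ_self k), Nat.cast_zero, zero_mul, add_zero,
      sum_range_succ' (fun i => (k.choose i : ℝ) * T i)]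
    simp
  linarith [h1]

/-- **Leibniz rule**: `D_k (f g)(j) = Σ_{i ≤ k} C(k,i) · D_i f (j) · D_{k-i} g (j+i)` for the Hausdorff
differences `D_k h (j) = Σ_{i ≤ k} (-1)^i C(k,i) h_{j+i}`. -/
theorem altSum_mul (f g : ℕ → ℝ) (k : ℕ) : ∀ j : ℕ,
    ∑ i ∈ range (k + 1), (-1 : ℝ) ^ i * (k.choose i : ℝ) * (f (j + i) * g (j + i)) =
      ∑ i ∈ range (k + 1), (k.choose i : ℝ) *
        ((∑ a ∈ range (i + 1), (-1 : ℝ) ^ a * (i.choose a : ℝ) * f (j + a)) *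
          ∑ b ∈ range (k - i + 1), (-1 : ℝ) ^ b * ((k - i).choose b : ℝ) * g (j + i + b)) := by
  induction k with
  | zero => intro j; simp
  | succ k ih =>
    intro j
    rw [altSum_succ' (fun r => f r * g r) k j, ih j, ih (j + 1)]
    -- abbreviations for the inner differences
    set F : ℕ → ℕ → ℝ := fun i j => ∑ a ∈ range (i + 1), (-1 : ℝ) ^ a * (i.choose a : ℝ) * f (j + a)
      with hF
    set G : ℕ → ℕ → ℝ := fun i j => ∑ b ∈ range (i + 1), (-1 : ℝ) ^ b * (i.choose b : ℝ) * g (j + b)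
      with hG
    have hFs : ∀ i j, F (i + 1) j = F i j - F i (j + 1) := fun i j => by
      simp only [hF]; exact altSum_succ' f i j
    have hGs : ∀ i j, G (i + 1) j = G i j - G i (j + 1) := fun i j => by
      simp only [hG]; exact altSum_succ' g i j
    have eL : ∀ j', (∑ i ∈ range (k + 1), (k.choose i : ℝ) *
        ((∑ a ∈ range (i + 1), (-1 : ℝ) ^ a * (i.choose a : ℝ) * f (j' + a)) *
          ∑ b ∈ range (k - i + 1), (-1 : ℝ) ^ b * ((k - i).choose b : ℝ) * g (j' + i + b))) =
        ∑ i ∈ range (k + 1), (k.choose i : ℝ) * (F i j' * G (k - i) (j' + i)) := fun j' => rfl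
    have eR : (∑ i ∈ range (k + 1 + 1), ((k + 1).choose i : ℝ) *
        ((∑ a ∈ range (i + 1), (-1 : ℝ) ^ a * (i.choose a : ℝ) * f (j + a)) *
          ∑ b ∈ range (k + 1 - i + 1), (-1 : ℝ) ^ b * ((k + 1 - i).choose b : ℝ) * g (j + i + b))) =
        ∑ i ∈ range (k + 2), ((k + 1).choose i : ℝ) * (F i j * G (k + 1 - i) (j + i)) := rfl
    rw [eL j, eL (j + 1), eR]
    have hsplit : ∀ i ∈ range (k + 1), (k.choose i : ℝ) * (F i j * G (k - i) (j + i)) -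
        (k.choose i : ℝ) * (F i (j + 1) * G (k - i) (j + 1 + i)) =
        (k.choose i : ℝ) * (F i j * G (k + 1 - i) (j + i)) +
          (k.choose i : ℝ) * (F (i + 1) j * G (k + 1 - (i + 1)) (j + (i + 1))) := by
      intro i hi
      rw [mem_range] at hi
      rw [show k + 1 - (i + 1) = k - i by omega, show k + 1 - i = (k - i) + 1 by omega, hGs, hFs,
        show j + 1 + i = j + i + 1 by ring, show j + (i + 1) = j + i + 1 by ring]
      ring
    rw [← sum_sub_distrib, sum_congr rfl hsplit, sum_add_distrib,
      pascal_sum (fun i => F i j * G (k + 1 - i) (j + i)) k]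

/-- Products of strictly completely monotone sequences are strictly completely monotone. -/
theorem altSum_mul_pos (f g : ℕ → ℝ)
    (hf : ∀ k j, 0 < ∑ i ∈ range (k + 1), (-1 : ℝ) ^ i * (k.choose i : ℝ) * f (j + i))
    (hg : ∀ k j, 0 < ∑ i ∈ range (k + 1), (-1 : ℝ) ^ i * (k.choose i : ℝ) * g (j + i)) (k j : ℕ) :
    0 < ∑ i ∈ range (k + 1), (-1 : ℝ) ^ i * (k.choose i : ℝ) * (f (j + i) * g (j + i)) := by
  rw [altSum_mul]
  refine sum_pos (fun i hi => ?_) (by simp)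
  rw [mem_range] at hi
  exact mul_pos (by exact_mod_cast Nat.choose_pos (by omega)) (mul_pos (hf i j) (hg (k - i) (j + i)))

/-- Finite (nonempty) products of Pochhammer ratios with `0 < a_t < b_t` are strictly completely
monotone. -/
theorem altSum_prod_pochRatio_pos (p : ℕ) : ∀ (a b : Fin (p + 1) → ℝ), (∀ t, 0 < a t) →
    (∀ t, a t < b t) → ∀ k j, 0 < ∑ i ∈ range (k + 1), (-1 : ℝ) ^ i * (k.choose i : ℝ) *
      ∏ t, ∏ m ∈ range (j + i), (a t + m) / (b t + m) := by
  induction p with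
  | zero =>
    intro a b ha hab k j
    simp only [Fin.prod_univ_succ, Fin.prod_univ_zero, mul_one]
    exact altSum_pochRatio_pos (a 0) (b 0) (ha 0) (hab 0) k j
  | succ p ih =>
    intro a b ha hab k j
    simp only [Fin.prod_univ_castSucc (n := p + 1)]
    exact altSum_mul_pos (fun r => ∏ t : Fin (p + 1), ∏ m ∈ range r, (a t.castSucc + m) / (b t.castSucc + m))
      (fun r => ∏ m ∈ range r, (a (Fin.last (p + 1)) + m) / (b (Fin.last (p + 1)) + m))
      (ih (fun t => a t.castSucc) (fun t => b t.castSucc) (fun t => ha _) (fun t => hab _))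
      (altSum_pochRatio_pos _ _ (ha _) (hab _)) k j

/-! ### THEOREM W -/

/-- **THEOREM W (Beta-product form).**  Let `0 < a_t < b_t` (`t ∈ Fin (p+1)`) and let `c_n > 0` satisfy
`m/(m + c_m) = ∏_t (a_t + m - 1)/(b_t + m - 1)` for `m ≥ 1` (equivalently `μ_r = r!/∏_{m≤r}(m+c_m)` is the
moment sequence of a product of independent `Beta(a_t, b_t - a_t)` variables).  Then
`[(l + c_n)/(n-l)!]_{l ≤ n}` is totally nonnegative.  Stieltjes-type `c = A - Σ w_i/(x+t_i)` (`c(0) > 0`) is the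
case `a_i = t_i + 1`, `b_i = s_{p-i} + 1` (memo §5); g34's two-ray `c` is of this type (memo §6). -/
theorem lPlusC_div_factorial_tn_of_pochRatio (p : ℕ) (a b : Fin (p + 1) → ℝ) (ha : ∀ t, 0 < a t)
    (hab : ∀ t, a t < b t) (c : ℕ → ℝ) (hc : ∀ n, 0 < c n)
    (hτ : ∀ m : ℕ, (((m + 1 : ℕ) : ℝ)) / (((m + 1 : ℕ) : ℝ) + c (m + 1)) = ∏ t, (a t + m) / (b t + m))
    {k : ℕ} (r c' : Fin k → ℕ) (hr : StrictMono r) (hc' : StrictMono c') :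
    0 ≤ (Matrix.of fun i j =>
      if c' j ≤ r i then ((c' j : ℝ) + c (r i)) / ((r i - c' j)! : ℕ) else 0).det := by
  have hprod : ∀ r, 0 < ∏ m ∈ range r, ((m : ℝ) + 1 + c (m + 1)) := fun r =>
    prod_pos fun m _ => by have := hc (m + 1); positivity
  -- μ_r = r!/∏(m+1+c_{m+1}) is the product of the Pochhammer ratios
  have hμ : ∀ r : ℕ, ((r ! : ℕ) : ℝ) / ∏ m ∈ range r, ((m : ℝ) + 1 + c (m + 1)) =
      ∏ t, ∏ m ∈ range r, (a t + m) / (b t + m) := by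
    intro r
    induction r with
    | zero => simp
    | succ r ih =>
      have hstep : ((r + 1)! : ℕ) / ∏ m ∈ range (r + 1), ((m : ℝ) + 1 + c (m + 1)) =
          ((r ! : ℕ) / ∏ m ∈ range r, ((m : ℝ) + 1 + c (m + 1))) *
            ((((r + 1 : ℕ) : ℝ)) / (((r + 1 : ℕ) : ℝ) + c (r + 1))) := by
        rw [prod_range_succ, Nat.factorial_succ, Nat.cast_mul, div_mul_div_comm]
        push_cast
        ring
      rw [hstep, ih, hτ r, ← prod_mul_distrib]
      refine prod_congr rfl fun t _ => ?_
      rw [prod_range_succ]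
  refine lPlusC_div_factorial_tn c hc (fun k j => ?_) r c' hr hc'
  simp only [hμ]
  exact altSum_prod_pochRatio_pos p a b ha hab k j

/-- The constant case `c ≡ A > 0` (`p = 0`, `a = 1`, `b = A + 1`; `μ = Beta(1, A)` moments):
`[(l + A)/(n-l)!]_{l ≤ n}` is totally nonnegative. -/
theorem lPlusC_div_factorial_tn_const (A : ℝ) (hA : 0 < A) {k : ℕ} (r c' : Fin k → ℕ) (hr : StrictMono r)
    (hc' : StrictMono c') :
    0 ≤ (Matrix.of fun i j =>
      if c' j ≤ r i then ((c' j : ℝ) + A) / ((r i - c' j)! : ℕ) else 0).det := by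
  refine lPlusC_div_factorial_tn_of_pochRatio 0 (fun _ => 1) (fun _ => A + 1) (fun _ => one_pos)
    (fun _ => by linarith) (fun _ => A) (fun _ => hA) (fun m => ?_) r c' hr hc'
  simp only [Fin.prod_univ_succ, Fin.prod_univ_zero, mul_one]
  push_cast
  ring

end MomentRatioTN

end Summit.CriticalPhenomena.PercolationContinuityZ3.Theorems
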